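import Mathlib.Topology.Algebra.Group.Basic
import Mathlib.GroupTheory.Commutator.Basic
import Mathlib.GroupTheory.Coset.Basic
import Mathlib.GroupTheory.Index
import Mathlib.GroupTheory.QuotientGroup.Basic
import Mathlib.Tactic.Group
import HarnessLib

/-!
# Class-two commutator calculus and "Heisenberg surjectivity" in compact groups
# ([EtTh] §1 p. 12: the structure of the theta group `Δ^Θ_X = Δ_X/[Δ_X,[Δ_X,Δ_X]]`; helper file)

Mochizuki, *The étale theta function and its Frobenioid-theoretic manifestations*, Publ. RIMS **45**
(2009) [EtTh], §1 PRIMS PDF p. 12: "`1 → ∧² Δ^ell_X (≅ Ẑ(1)) → Δ^Θ_X → Δ^ell_X → 1` — where we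
write `Δ^Θ_X := Δ_X/[Δ_X,[Δ_X,Δ_X]]`" and §2 p. 45 "the well-known structure of the theta-group";
the commutator identities are the Witt–Hall identities, Magnus–Karrass–Solitar, *Combinatorial
Group Theory* (1966), §5.2 Theorem 5.1 p. 290 [cite: MagnusKarrassSolitar1966, Thm 5.1 §5.2 p.290].
Layer L2 of the abc-iut cell (item N8 of abc-iut-L2-t8's adapter report = abc-iut-L2-t10's
hypothesis `hcomm`), seat abc-iut-L5-t14; consumed by `Sec2ThetaGroupCommutators.lean`.
THEOREMS ONLY (Mathlib-only imports), no definition, no named fact.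

CONTENT (sub-namespace `ClassTwo`; everything relative to subgroups `A, K₂, K₃ ≤ G` with
`[A, A] ≤ K₂ ≤ A`, `[A, K₂] ≤ K₃`, `K₃` normal — "class two relative to `K₂` modulo `K₃`"):
* `mk_mul_comm_of_mem`, `mk_commutator_mul_left/right`, `mk_commutator_zpow_left/right`,
  `mk_commutator_inv_right` — bilinearity of `(x, y) ↦ [x, y]` on `A` with values central in
  `G/K₃` (Witt–Hall identities);
* `relIndex_sup_eq_relIndex` — `[H ⊔ N : H] = [N : H ∩ N]` for `N` normal (the companion of
  Mathlib's `Subgroup.relIndex_sup_right`);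
* `commutator_topologicalClosure_right_le/left_le` — `[A, B⁻] ≤ [A, B]⁻`;
* `exists_commutator_mul_of_mem_closure` — HEISENBERG SURJECTIVITY: in a compact Hausdorff
  group, if `N ≤ A` is closed and abelian modulo `K₃` and a subgroup `T ⊆ z^ℤ·N` is dense in `A`,
  then every element of `[A, A]⁻` is `[z, n]·k`, `n ∈ N`, `k ∈ K₃` (the set of such products is a
  closed subgroup by compactness and bilinearity, and contains `[T, T]` hence `[A, A]⁻`);
* `isClosed_map_subtype_comap`, `mem_of_coe_mem_map_subtype_comap` — transport through a closed
  subgroup of preimages under a continuous homomorphism to a discrete group.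
HONEST FRAMING: classical group theory; nothing of [EtTh] is asserted here.
-/

namespace Literature.AnabelianGeometry.EtaleTheta.ClassTwo

open _root_.Topology
open scoped commutatorElement

/-! ### Class-two commutator calculus modulo `K₃` (Witt–Hall identities) -/

section Algebra

variable {G : Type*} [Group G] (A K₂ K₃ : Subgroup G) [K₃.Normal]

/-- Centrality modulo `K₃`: if `[A, K₂] ≤ K₃` then the images in `G/K₃` of `x ∈ A` and `c ∈ K₂`
commute.
[cite: MagnusKarrassSolitar1966, Thm 5.1 §5.2 p.290] -/
theorem mk_mul_comm_of_mem (hAK : ⁅A, K₂⁆ ≤ K₃) {x c : G} (hx : x ∈ A) (hc : c ∈ K₂) :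
    (x : G ⧸ K₃) * c = c * x := by
  have h1 : ((x * c * x⁻¹ * c⁻¹ : G) : G ⧸ K₃) = 1 := by
    rw [QuotientGroup.eq_one_iff, ← commutatorElement_def]
    exact hAK (Subgroup.commutator_mem_commutator hx hc)
  simp only [QuotientGroup.mk_mul, QuotientGroup.mk_inv] at h1
  rw [mul_inv_eq_one, mul_inv_eq_iff_eq_mul] at h1
  exact h1

/-- Bilinearity in the first slot modulo `K₃`: `[x x', y] ≡ [x, y] [x', y]` for `x, x', y ∈ A`,
when `[A, A] ≤ K₂`, `K₂ ≤ A`, `[A, K₂] ≤ K₃`.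
[cite: MagnusKarrassSolitar1966, Thm 5.1 §5.2 p.290] -/
theorem mk_commutator_mul_left (hAA : ⁅A, A⁆ ≤ K₂) (hK₂A : K₂ ≤ A) (hAK : ⁅A, K₂⁆ ≤ K₃)
    {x x' y : G} (hx : x ∈ A) (hx' : x' ∈ A) (hy : y ∈ A) :
    ((⁅x * x', y⁆ : G) : G ⧸ K₃) = (⁅x, y⁆ : G) * (⁅x', y⁆ : G) := by
  have hid : (⁅x * x', y⁆ : G) = x * ⁅x', y⁆ * x⁻¹ * ⁅x, y⁆ := by
    simp only [commutatorElement_def]; group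
  have hc' : ⁅x', y⁆ ∈ K₂ := hAA (Subgroup.commutator_mem_commutator hx' hy)
  have hc : ⁅x, y⁆ ∈ K₂ := hAA (Subgroup.commutator_mem_commutator hx hy)
  rw [hid, QuotientGroup.mk_mul, QuotientGroup.mk_mul, QuotientGroup.mk_mul, QuotientGroup.mk_inv,
    mk_mul_comm_of_mem A K₂ K₃ hAK hx hc', mul_inv_cancel_right,
    mk_mul_comm_of_mem A K₂ K₃ hAK (hK₂A hc') hc]

/-- Bilinearity in the second slot modulo `K₃`: `[x, y y'] ≡ [x, y] [x, y']`.
[cite: MagnusKarrassSolitar1966, Thm 5.1 §5.2 p.290] -/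
theorem mk_commutator_mul_right (hAA : ⁅A, A⁆ ≤ K₂) (hAK : ⁅A, K₂⁆ ≤ K₃)
    {x y y' : G} (hx : x ∈ A) (hy : y ∈ A) (hy' : y' ∈ A) :
    ((⁅x, y * y'⁆ : G) : G ⧸ K₃) = (⁅x, y⁆ : G) * (⁅x, y'⁆ : G) := by
  have hid : (⁅x, y * y'⁆ : G) = ⁅x, y⁆ * (y * ⁅x, y'⁆ * y⁻¹) := by
    simp only [commutatorElement_def]; group
  have hc' : ⁅x, y'⁆ ∈ K₂ := hAA (Subgroup.commutator_mem_commutator hx hy')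
  rw [hid, QuotientGroup.mk_mul, QuotientGroup.mk_mul, QuotientGroup.mk_mul, QuotientGroup.mk_inv,
    mk_mul_comm_of_mem A K₂ K₃ hAK hy hc', mul_inv_cancel_right]

/-- Powers in the first slot modulo `K₃`: `[x ^ i, y] ≡ [x, y] ^ i`.
[cite: MagnusKarrassSolitar1966, Thm 5.1 §5.2 p.290] -/
theorem mk_commutator_zpow_left (hAA : ⁅A, A⁆ ≤ K₂) (hK₂A : K₂ ≤ A) (hAK : ⁅A, K₂⁆ ≤ K₃)
    {x y : G} (hx : x ∈ A) (hy : y ∈ A) (i : ℤ) :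
    ((⁅x ^ i, y⁆ : G) : G ⧸ K₃) = (((⁅x, y⁆ : G) : G ⧸ K₃)) ^ i := by
  let f : A →* G ⧸ K₃ :=
    { toFun := fun a => ((⁅(a : G), y⁆ : G) : G ⧸ K₃)
      map_one' := by simp only [OneMemClass.coe_one, commutatorElement_one_left, QuotientGroup.mk_one]
      map_mul' := fun a b => by
        simp only [Subgroup.coe_mul]
        exact mk_commutator_mul_left A K₂ K₃ hAA hK₂A hAK a.2 b.2 hy }
  have h := map_zpow f ⟨x, hx⟩ i
  simpa [f] using h

/-- Powers in the second slot modulo `K₃`: `[x, y ^ i] ≡ [x, y] ^ i`.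
[cite: MagnusKarrassSolitar1966, Thm 5.1 §5.2 p.290] -/
theorem mk_commutator_zpow_right (hAA : ⁅A, A⁆ ≤ K₂) (hAK : ⁅A, K₂⁆ ≤ K₃)
    {x y : G} (hx : x ∈ A) (hy : y ∈ A) (i : ℤ) :
    ((⁅x, y ^ i⁆ : G) : G ⧸ K₃) = (((⁅x, y⁆ : G) : G ⧸ K₃)) ^ i := by
  let f : A →* G ⧸ K₃ :=
    { toFun := fun a => ((⁅x, (a : G)⁆ : G) : G ⧸ K₃)
      map_one' := by simp only [OneMemClass.coe_one, commutatorElement_one_right, QuotientGroup.mk_one]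
      map_mul' := fun a b => by
        simp only [Subgroup.coe_mul]
        exact mk_commutator_mul_right A K₂ K₃ hAA hAK hx a.2 b.2 }
  have h := map_zpow f ⟨y, hy⟩ i
  simpa [f] using h

/-- Inverses in the second slot modulo `K₃`: `[x, y⁻¹] ≡ [x, y]⁻¹`.
[cite: MagnusKarrassSolitar1966, Thm 5.1 §5.2 p.290] -/
theorem mk_commutator_inv_right (hAA : ⁅A, A⁆ ≤ K₂) (hAK : ⁅A, K₂⁆ ≤ K₃)
    {x y : G} (hx : x ∈ A) (hy : y ∈ A) :
    ((⁅x, y⁻¹⁆ : G) : G ⧸ K₃) = (((⁅x, y⁆ : G) : G ⧸ K₃))⁻¹ := by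
  have h := mk_commutator_zpow_right A K₂ K₃ hAA hAK hx hy (-1)
  simpa using h

/-- `[H ⊔ N : H] = [N : H ∩ N]` for `N` normal: the coset map `N/(H ∩ N) → (H ⊔ N)/H` induced by the
inclusion is a bijection (onto because `H ⊔ N = N · H`).  Mathlib has the companion
`Subgroup.relIndex_sup_right` (`[H ⊔ N : N] = [H : H ∩ N]`) only.  Used for the degree
bookkeeping "`Y̲̲ → Y` of degree `l`" of [EtTh] Def. 2.7. [cite: MochizukiEtTh2009, Def 2.7 p.41] -/
theorem relIndex_sup_eq_relIndex (H N : Subgroup G) [N.Normal] :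
    H.relIndex (H ⊔ N) = H.relIndex N := by
  unfold Subgroup.relIndex Subgroup.index
  refine (Nat.card_congr (Equiv.ofBijective
    (Subgroup.quotientSubgroupOfEmbeddingOfLE H (le_sup_right : N ≤ H ⊔ N)) ⟨?_, ?_⟩)).symm
  · exact (Subgroup.quotientSubgroupOfEmbeddingOfLE H _).injective
  · rintro ⟨x⟩
    obtain ⟨h, hh, n, hn, hx⟩ := Subgroup.mem_sup_of_normal_right.mp x.2
    refine ⟨QuotientGroup.mk ⟨h * n * h⁻¹, Subgroup.Normal.conj_mem inferInstance n hn h⟩, ?_⟩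
    rw [Subgroup.quotientSubgroupOfEmbeddingOfLE_apply_mk]
    change (QuotientGroup.mk (Subgroup.inclusion _ ⟨h * n * h⁻¹, _⟩) : _ ⧸ H.subgroupOf (H ⊔ N)) =
      QuotientGroup.mk x
    rw [QuotientGroup.eq, Subgroup.mem_subgroupOf]
    change ((h * n * h⁻¹)⁻¹ * (x : G)) ∈ H
    rw [← hx]
    convert hh using 1
    group

end Algebra

/-! ### Topological groups: closures of commutators, Heisenberg surjectivity -/

section Generic

variable {G : Type*} [Group G] [TopologicalSpace G] [IsTopologicalGroup G]

/-- `[A, B⁻] ≤ [A, B]⁻`: for fixed `a` the map `b ↦ [a, b]` is continuous.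
[cite: MochizukiEtTh2009, §1 p.12] -/
theorem commutator_topologicalClosure_right_le (A B : Subgroup G) :
    ⁅A, B.topologicalClosure⁆ ≤ (⁅A, B⁆).topologicalClosure := by
  rw [Subgroup.commutator_le]
  intro a ha b hb
  have hc : Continuous fun x : G => a * x * a⁻¹ * x⁻¹ := by fun_prop
  have himg : (fun x : G => a * x * a⁻¹ * x⁻¹) '' (B : Set G) ⊆ (⁅A, B⁆ : Subgroup G) := by
    rintro _ ⟨x, hx, rfl⟩
    exact Subgroup.commutator_mem_commutator ha hx
  have hb' : b ∈ closure (B : Set G) := by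
    rw [← Subgroup.topologicalClosure_coe]; exact hb
  have hmem : a * b * a⁻¹ * b⁻¹ ∈ ((⁅A, B⁆ : Subgroup G).topologicalClosure : Set G) := by
    rw [Subgroup.topologicalClosure_coe]
    exact closure_mono himg (image_closure_subset_closure_image hc ⟨b, hb', rfl⟩)
  rw [commutatorElement_def]
  exact hmem

/-- `[A⁻, B] ≤ [A, B]⁻`.
[cite: MochizukiEtTh2009, §1 p.12] -/
theorem commutator_topologicalClosure_left_le (A B : Subgroup G) :
    ⁅A.topologicalClosure, B⁆ ≤ (⁅A, B⁆).topologicalClosure := by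
  rw [Subgroup.commutator_comm, Subgroup.commutator_comm A]
  exact commutator_topologicalClosure_right_le B A

/-- **Heisenberg surjectivity, generic form.**  Let `G` be a compact Hausdorff topological group,
`A, K₂, K₃ ≤ G` with `K₃` normal and closed, `[A, A] ≤ K₂ ≤ A`, `[A, K₂] ≤ K₃` (so `A/K₃` has class
`≤ 2` relative to `K₂`), `z ∈ A`, `N ≤ A` closed and abelian modulo `K₃`, and `T ≤ z^ℤ · N` a
subgroup whose closure contains `A`.  Then every element of `[A, A]⁻` is `[z, n] · k` with `n ∈ N`,
`k ∈ K₃`: the set of such products is a closed subgroup (compactness + bilinearity) containing all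
`[t, t']`, `t, t' ∈ T`, hence, by density and continuity of the commutator, all of `[A, A]`.
[cite: MochizukiEtTh2009, §1 p.12] -/
theorem exists_commutator_mul_of_mem_closure [CompactSpace G] [T2Space G]
    (A K₂ K₃ : Subgroup G) [K₃.Normal] (hAA : ⁅A, A⁆ ≤ K₂) (hK₂A : K₂ ≤ A) (hAK : ⁅A, K₂⁆ ≤ K₃)
    (hK₃ : IsClosed (K₃ : Set G)) {z : G} (hz : z ∈ A) (N : Subgroup G) (hNA : N ≤ A)
    (hN : IsClosed (N : Set G)) (hNab : ⁅N, N⁆ ≤ K₃) (T : Subgroup G)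
    (hAT : (A : Set G) ⊆ closure (T : Set G)) (hT : ∀ t ∈ T, ∃ i : ℤ, ∃ n ∈ N, t = z ^ i * n) :
    ∀ k ∈ (⁅A, A⁆).topologicalClosure, ∃ n ∈ N, ∃ k₃ ∈ K₃, k = ⁅z, n⁆ * k₃ := by
  -- the subgroup `S = {g | ∃ n ∈ N, g ≡ [z, n] mod K₃}`
  let S : Subgroup G :=
    { carrier := {g | ∃ n ∈ N, (g : G ⧸ K₃) = ((⁅z, n⁆ : G) : G ⧸ K₃)}
      one_mem' := ⟨1, N.one_mem, by rw [commutatorElement_one_right]⟩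
      mul_mem' := by
        rintro g g' ⟨n, hn, hg⟩ ⟨n', hn', hg'⟩
        refine ⟨n * n', N.mul_mem hn hn', ?_⟩
        rw [QuotientGroup.mk_mul, hg, hg',
          mk_commutator_mul_right A K₂ K₃ hAA hAK hz (hNA hn) (hNA hn')]
      inv_mem' := by
        rintro g ⟨n, hn, hg⟩
        refine ⟨n⁻¹, N.inv_mem hn, ?_⟩
        rw [QuotientGroup.mk_inv, hg, mk_commutator_inv_right A K₂ K₃ hAA hAK hz (hNA hn)] }
  have hS_mem : ∀ g : G, g ∈ S ↔ ∃ n ∈ N, (g : G ⧸ K₃) = ((⁅z, n⁆ : G) : G ⧸ K₃) := fun g => Iff.rfl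
  -- `S` is closed: it is the image of the compact set `N × K₃` under `(n, k) ↦ [z, n] k`
  have hS_eq : (S : Set G) =
      (fun q : G × G => (⁅z, q.1⁆ : G) * q.2) '' ((N : Set G) ×ˢ (K₃ : Set G)) := by
    ext g
    constructor
    · rintro ⟨n, hn, hg⟩
      refine ⟨(n, (⁅z, n⁆ : G)⁻¹ * g), ⟨hn, ?_⟩, mul_inv_cancel_left _ _⟩
      change (⁅z, n⁆ : G)⁻¹ * g ∈ K₃
      rw [← QuotientGroup.eq]
      exact hg.symm
    · rintro ⟨⟨n, k⟩, ⟨hn, hk⟩, rfl⟩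
      refine ⟨n, hn, ?_⟩
      change (((⁅z, n⁆ : G) * k : G) : G ⧸ K₃) = _
      rw [QuotientGroup.mk_mul, (QuotientGroup.eq_one_iff k).mpr hk, mul_one]
  have hS_closed : IsClosed (S : Set G) := by
    rw [hS_eq]
    have hcont : Continuous fun q : G × G => (⁅z, q.1⁆ : G) * q.2 := by
      simp only [commutatorElement_def]; fun_prop
    exact ((hN.isCompact.prod hK₃.isCompact).image hcont).isClosed
  -- commutators of elements of `T ⊆ z^ℤ N` lie in `S` (bilinearity; `N` abelian mod `K₃`)
  have hT_comm : ∀ t ∈ T, ∀ t' ∈ T, (⁅t, t'⁆ : G) ∈ S := by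
    intro t ht t' ht'
    obtain ⟨i, n, hn, rfl⟩ := hT t ht
    obtain ⟨j, n', hn', rfl⟩ := hT t' ht'
    rw [hS_mem]
    refine ⟨n' ^ i * n ^ (-j), N.mul_mem (N.zpow_mem hn' i) (N.zpow_mem hn (-j)), ?_⟩
    have hzi : z ^ i ∈ A := A.zpow_mem hz i
    have hzj : z ^ j ∈ A := A.zpow_mem hz j
    have hnA : n ∈ A := hNA hn
    have hn'A : n' ∈ A := hNA hn'
    have hzz : ((⁅z ^ i, z ^ j⁆ : G) : G ⧸ K₃) = 1 := by
      rw [(commutatorElement_eq_one_iff_commute).mpr ((Commute.refl z).zpow_zpow i j),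
        QuotientGroup.mk_one]
    have hnn : ((⁅n, n'⁆ : G) : G ⧸ K₃) = 1 :=
      (QuotientGroup.eq_one_iff _).mpr (hNab (Subgroup.commutator_mem_commutator hn hn'))
    have hnz : ((⁅n, z ^ j⁆ : G) : G ⧸ K₃) = (((⁅z, n⁆ : G) : G ⧸ K₃) ^ j)⁻¹ := by
      rw [← mk_commutator_zpow_left A K₂ K₃ hAA hK₂A hAK hz hnA j, ← QuotientGroup.mk_inv,
        commutatorElement_inv]
    rw [mk_commutator_mul_left A K₂ K₃ hAA hK₂A hAK hzi hnA (A.mul_mem hzj hn'A),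
      mk_commutator_mul_right A K₂ K₃ hAA hAK hzi hzj hn'A,
      mk_commutator_mul_right A K₂ K₃ hAA hAK hnA hzj hn'A, hzz, hnn, hnz, one_mul, mul_one,
      mk_commutator_zpow_left A K₂ K₃ hAA hK₂A hAK hz hn'A i,
      mk_commutator_mul_right A K₂ K₃ hAA hAK hz (A.zpow_mem hn'A i) (A.zpow_mem hnA (-j)),
      mk_commutator_zpow_right A K₂ K₃ hAA hAK hz hn'A i,
      mk_commutator_zpow_right A K₂ K₃ hAA hAK hz hnA (-j), zpow_neg]
  -- density: every `[a, a']`, `a, a' ∈ A`, lies in the closed set `S`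
  have hcont : Continuous fun q : G × G => (⁅q.1, q.2⁆ : G) := by
    simp only [commutatorElement_def]; fun_prop
  have hP_closed : IsClosed ((fun q : G × G => (⁅q.1, q.2⁆ : G)) ⁻¹' (S : Set G)) :=
    hS_closed.preimage hcont
  have hsub : (T : Set G) ×ˢ (T : Set G) ⊆ (fun q : G × G => (⁅q.1, q.2⁆ : G)) ⁻¹' (S : Set G) := by
    rintro ⟨t, t'⟩ ⟨ht, ht'⟩
    exact hT_comm t ht t' ht'
  have hAA_S : ∀ a ∈ A, ∀ a' ∈ A, (⁅a, a'⁆ : G) ∈ S := by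
    intro a ha a' ha'
    have hmem : (a, a') ∈ closure ((T : Set G) ×ˢ (T : Set G)) := by
      rw [closure_prod_eq]; exact ⟨hAT ha, hAT ha'⟩
    exact (hP_closed.closure_subset_iff.mpr hsub) hmem
  have hle : (⁅A, A⁆).topologicalClosure ≤ S :=
    Subgroup.topologicalClosure_minimal _ (Subgroup.commutator_le.mpr hAA_S) hS_closed
  intro k hk
  obtain ⟨n, hn, hk'⟩ := hle hk
  refine ⟨n, hn, (⁅z, n⁆ : G)⁻¹ * k, ?_, (mul_inv_cancel_left _ _).symm⟩
  rw [← QuotientGroup.eq]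
  exact hk'.symm

omit [IsTopologicalGroup G] in
/-- For a closed subgroup `P ≤ G` and a continuous homomorphism `F : P → Q` to a discrete group,
the pull-back to `G` of any subgroup `C ≤ Q` (`(F⁻¹ C)` pushed into `G`) is closed.
[cite: MochizukiEtTh2009, §1 p.12] -/
theorem isClosed_map_subtype_comap {P : Subgroup G} (hP : IsClosed (P : Set G))
    {Q : Type*} [Group Q] [TopologicalSpace Q] [DiscreteTopology Q] (F : P →* Q)
    (hF : Continuous F) (C : Subgroup Q) :
    IsClosed ((((C.comap F).map P.subtype : Subgroup G)) : Set G) := by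
  rw [Subgroup.coe_map, Subgroup.coe_subtype]
  exact hP.isClosedMap_subtype_val _ ((isClosed_discrete (C : Set Q)).preimage hF)

omit [TopologicalSpace G] [IsTopologicalGroup G] in
/-- Membership transport for `isClosed_map_subtype_comap`: if `g ∈ (F⁻¹ C)` pushed into `G`, then
`F g ∈ C`.
[cite: MochizukiEtTh2009, §1 p.12] -/
theorem mem_of_coe_mem_map_subtype_comap {P : Subgroup G} {Q : Type*} [Group Q]
    (F : P →* Q) (C : Subgroup Q) {g : P}
    (hg : (g : G) ∈ ((C.comap F).map P.subtype : Subgroup G)) : F g ∈ C := by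
  obtain ⟨g', hg', hgg'⟩ := hg
  rw [Subgroup.coe_subtype] at hgg'
  rw [← Subtype.ext hgg']
  exact hg'

end Generic

end Literature.AnabelianGeometry.EtaleTheta.ClassTwo
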